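import Mathlib
import Summits.ValiantsHypothesis.ValiantsHypothesis.Theses.BorderApolarity
import Summits.ValiantsHypothesis.ValiantsHypothesis.Theses.RigidityForcesSymmetry
import Summits.ValiantsHypothesis.ValiantsHypothesis.Theorems.RigidityForcesSymmetryGrenetBoundToVH
import Literature.Computability.AlgebraicComplexity.EquivariantDC
import Summits.ValiantsHypothesis.ValiantsHypothesis.Theorems.BorderApolarityToricWitnessObstructionQPStableNormalFormIff
import Summits.ValiantsHypothesis.ValiantsHypothesis.Theorems.BorderApolarityToricWitnessObstructionQPCleanBorel
import Summits.ValiantsHypothesis.ValiantsHypothesis.Theorems.BorderApolarityToricWitnessObstructionQPContentGrading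
import Summits.ValiantsHypothesis.ValiantsHypothesis.Theorems.BorderApolarityToricWitnessObstructionQPStubTorusBound

/-!
# Border apolarity, crux `ToricWitnessObstructionQP` (stmt-ValiantsHypothesis-14753) — line `Sketch`,
# RESHAPE 5 (lead c3): EQUIVARIANT CORE + the exact two-sided torus count (the latter LANDED, p140369)

Route `ValiantsHypothesis/BorderApolarity`, crux item `stmt-ValiantsHypothesis-14753`, line `Sketch`.

History.  Reshapes 1–3 (leads 0, c1) ended on `stub_noTLFQP` (VH-sized: drops W4).  Reshape 4
(lead c2) threaded W4 through the normal form and ended on ONE stub, `stub_noStableNormalFormQP`,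
which is a THEOREM-EQUIVALENT of the crux (`…StableNormalFormIff.lean`), i.e. carries no reduction.
Lead c3 (this reshape) found, by exact computation, that (a) fully valid stable normal forms WITH
GARBAGE exist at (2,4) and, up to the last (Borel) test — passed at level 2 after a generic
recombination of the unused frame — at (3,7), so no window-free or level-wise impossibility can close
the residual; (b) the natural equivariantisation routes for the GIVEN frame (limit Lie algebra onto the
own torus, Białynicki-Birula purification, forced tightness) are FALSE on valid data; but (c) in every
valid datum found, the limit spaces CONTAIN the minor system of an honest TWO-SIDED-TORUS-EQUIVARIANT
affine determinantal representation of `per_n` of the same size (Grenet(2), Grenet(3): the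
"equivariant core").  Reshape 5 makes that the line's one structural bet and glues it to the
existing exact torus count:

* `stub_equivariantCore` (NEW, open, the line's content): a toric H₀-stable border-apolar witness at
  `(n, m)`, `3 ≤ n ≤ m`, forces an honest affine determinantal representation of `per_n` of size
  `≤ m` with EXACT lifts of the two-sided torus `x_(k,l) ↦ d_k e_l x_(k,l)`.  (Why plausibly true:
  the limit is a module for the full own torus (content grading, `…ContentGrading.lean`), for the
  vector group `Hom(unused, own)` and for a Borel of `GL(unused)` (`…CleanBorel.lean`); its top levels
  are the cofactor/minor spans of the core in all computed examples.  Why it might fail: a valid datum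
  at (3,5) or (3,6), or one at (3,8) built around a non-equivariant honest representation whose limit
  contains no equivariant minor system.)
* `stub_torusBound` — VERBATIM the open crux `RigidityForcesSymmetry.TorusBound`
  (stmt-ValiantsHypothesis-4164, difficulty L; also the `stub_torusBound` of the 2026-08-17 piece
  `UnpaddedGIT.TorusEquivariantBorderQP`): two-sided-torus-equivariant affine representations of
  `per_n`, `n ≥ 3`, have size `≥ 2^n − 1`.
* Composition `ToricWitnessObstructionQP_of` (real proof): a witness in the window gives an
  equivariant representation of size `m₁ ≤ m ≤ 2^((log₂ n + c)^c) < 2^n − 1 ≤ m₁` for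
  `n ≥ N(c)` (`RigidityForcesSymmetryGrenetBoundToVH.eventually_two_pow_qpExp_lt`), absurd.

The landed normal-form chain of reshape 4 (stubs 1–6, the iff theorem, bigrading, shadow feeding,
dimension, clean Borel, content grading) is exactly the tool kit for proving `stub_equivariantCore`;
it is imported here so that the skeleton's closure records it.
-/

open MvPolynomial Filter
open scoped BigOperators Matrix
open Literature.Computability.AlgebraicComplexity

-- the mandated summit-side namespace repeats a component by design (single-problem summit)
set_option linter.dupNamespace false

namespace Summit.ValiantsHypothesis.ValiantsHypothesis.Theorems.BorderApolarityToricWitnessObstructionQP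

noncomputable section

/-! ## Registered stubs -/

/-- **Stub A — EQUIVARIANT CORE (OPEN; the line's structural bet, lead c3).**  For `3 ≤ n ≤ m`, a
toric H₀(n,m)-stable border-apolar witness `(u, g, w, J)` for the padded permanent (the `∃`-body of
the crux, verbatim) forces an honest affine determinantal representation of `per_n` of some size
`m₁ ≤ m` which is EQUIVARIANT, with exact lifts, for the two-sided torus
`x_(k,l) ↦ d_k e_l x_(k,l)`.  Evidence: in every fully/near-valid stable normal form computed
(lead c3: (2,3), (2,4), (3,7)) the limit spaces contain the minor system of Grenet's representation,
which is two-sided-torus-equivariant of size `2^n − 1`. [folklore] -/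
theorem stub_equivariantCore : ∀ (n m : ℕ) [NeZero m], 3 ≤ n → n ≤ m → (let act := fun (D f : MvPolynomial (Fin m × Fin m) ℂ) => ∑ e ∈ D.support, ∑ d ∈ f.support, MvPolynomial.monomial (d - e) (MvPolynomial.coeff e D * MvPolynomial.coeff d f * ∏ i ∈ e.support, (Nat.descFactorial (d i) (e i) : ℂ)); let rk := fun (p : Fin m × Fin m) => (if (m - n ≤ (p.1 : ℕ) ∧ m - n ≤ (p.2 : ℕ)) ∨ p = (0, 0) then 0 else m * m) + ((p.1 : ℕ) * m + (p.2 : ℕ)); ∃ (u g : Matrix.GeneralLinearGroup (Fin m × Fin m) ℂ) (w : Fin m × Fin m → ℤ) (J : ℕ → Set (MvPolynomial (Fin m × Fin m) ℂ)), let Q : ℕ → MvPolynomial (Fin m × Fin m) ℂ := fun t => Literature.Computability.AlgebraicComplexity.linSubst (Fin m × Fin m) ℂ (u : Matrix (Fin m × Fin m) (Fin m × Fin m) ℂ) (Literature.Computability.AlgebraicComplexity.linSubst (Fin m × Fin m) ℂ (Matrix.diagonal fun i : Fin m × Fin m => ((t : ℂ) + 2) ^ (w i)) (Literature.Computability.AlgebraicComplexity.linSubst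 (Fin m × Fin m) ℂ (g : Matrix (Fin m × Fin m) (Fin m × Fin m) ℂ) (Literature.Computability.AlgebraicComplexity.detPoly (Fin m) ℂ))); (∀ k ≤ m, ∀ D ∈ J k, ∃ Ds : ℕ → MvPolynomial (Fin m × Fin m) ℂ, (∀ t, (Ds t).IsHomogeneous k ∧ act (Ds t) (Q t) = 0) ∧ Filter.Tendsto (fun t => Literature.Computability.AlgebraicComplexity.coeffVec (Ds t)) Filter.atTop (nhds (Literature.Computability.AlgebraicComplexity.coeffVec D))) ∧ (∀ k ≤ m, ∀ (D : MvPolynomial (Fin m × Fin m) ℂ) (φ : ℕ → ℕ) (Ds : ℕ → MvPolynomial (Fin m × Fin m) ℂ), StrictMono φ → (∀ t, (Ds t).IsHomogeneous k ∧ act (Ds t) (Q (φ t)) = 0) → Filter.Tendsto (fun t => Literature.Computability.AlgebraicComplexity.coeffVec (Ds t)) Filter.atTop (nhds (Literature.Computability.AlgebraicComplexity.coeffVec D)) → D ∈ J k) ∧ (∀ A : Matrix.GeneralLinearGroup (Fin m × Fin m) ℂ, let M : Matrix (Fin m × Fin m) (Fin m × Fin m) ℂ := A; (∀ i j : Fin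 m × Fin m, M j i ≠ 0 → rk j ≤ rk i) → (∀ i j : Fin m × Fin m, ((m - n ≤ (i.1 : ℕ) ∧ m - n ≤ (i.2 : ℕ)) ∨ i = (0, 0)) → j ≠ i → M j i = 0) → (∀ i k j l : Fin m, m - n ≤ (i : ℕ) → m - n ≤ (k : ℕ) → m - n ≤ (j : ℕ) → m - n ≤ (l : ℕ) → M (i, j) (i, j) * M (k, l) (k, l) = M (i, l) (i, l) * M (k, j) (k, j)) → M (0, 0) (0, 0) ^ (m - n) * ∏ i ∈ Finset.univ.filter (fun i : Fin m => m - n ≤ (i : ℕ)), M (i, i) (i, i) = 1 → ∀ k ≤ m, ∀ D ∈ J k, Literature.Computability.AlgebraicComplexity.linSubst (Fin m × Fin m) ℂ Mᵀ D ∈ J k) ∧ (∀ k ≤ m, ∀ D ∈ J k, act D (Literature.Computability.AlgebraicComplexity.paddedPerPoly ℂ n m) = 0)) → ∃ m₁ : ℕ, m₁ ≤ m ∧ Literature.Computability.AlgebraicComplexity.HasEquivariantDetRepr (Subgroup.closure {γ : GL (Fin n × Fin n) ℂ | ∃ d e : Fin n → ℂ, (γ : Matrix (Fin n × Fin n) (Fin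 n × Fin n) ℂ) = Matrix.diagonal (fun p => d p.1 * e p.2)}) (Literature.Computability.AlgebraicComplexity.perPoly (Fin n) ℂ) m₁ := by
  sorry

/-! Stub B of reshape 5, `stub_torusBound : RigidityForcesSymmetry.TorusBound` (the exact two-sided
torus count, = open crux stmt-ValiantsHypothesis-4164), was LANDED by the lead's wave-1 worker:
`…Theorems.BorderApolarityToricWitnessObstructionQPStubTorusBound` (p140369, sorry-free; one generic
torus element, the pencil on the graph of each permutation, and the hitting-set count
`#{σ : σ(I) = J} ≤ |I|!(m−|I|)!`).  It is imported above; ONE stub remains. -/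

/-! ## The composition -/

/-- **Line `Sketch`, reshape 5, closes crux 4 modulo its two stubs.**  A toric witness at `(n, m)`
in the window gives (Stub A) a two-sided-torus-equivariant affine representation of `per_n` of size
`m₁ ≤ m`; Stub B gives `2^n − 1 ≤ m₁`; and `m ≤ 2^((log₂ n + c)^c) < 2^n − 1` for `n ≥ N(c)`.
[folklore] -/
theorem ToricWitnessObstructionQP_of :
    Summit.ValiantsHypothesis.ValiantsHypothesis.Theses.BorderApolarity.ToricWitnessObstructionQP := by
  intro c
  obtain ⟨N, hN⟩ := RigidityForcesSymmetryGrenetBoundToVH.eventually_two_pow_qpExp_lt c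
  refine ⟨max N 3, ?_⟩
  intro n hn m inst hnm hm
  have h3 : 3 ≤ n := le_trans (le_max_right _ _) hn
  have hN' : N ≤ n := le_trans (le_max_left _ _) hn
  intro act rk hW
  obtain ⟨m₁, hm₁, A, hA⟩ := stub_equivariantCore n m h3 hnm hW
  have hcount : 2 ^ n - 1 ≤ m₁ := stub_torusBound n h3 m₁ A hA
  have hlt : 2 ^ ((Nat.log 2 n + c) ^ c) < 2 ^ n - 1 := hN n hN'
  omega

end

end Summit.ValiantsHypothesis.ValiantsHypothesis.Theorems.BorderApolarityToricWitnessObstructionQP
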